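import Mathlib
import HarnessLib
import Summits.NavierStokesRegularity.NavierStokesRegularity.Theorems.ThreadingFluxHorizonTowerNullConeDivisibility
import Summits.NavierStokesRegularity.NavierStokesRegularity.Theorems.ThreadingFluxHorizonTowerNullConeBinaryForms

/-!
# Route `UnthreadedRigidityDoor`, item `UnthreadedRigidity` (W2, stmt-NavierStokesRegularity-27585) — LINE g12-1 «CO-ZONAL» / g12-2 «PERSISTENCE»:
# THE TOP-COMPONENT LEMMAS FOR SOLID HARMONICS, in the null-cone chart currency — `chartT(Y)² ≠ 0` AND ★ `chartT(|∇Y|²) ≠ 0`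

Prover file (engine-1 g74; `--supports stmt-NavierStokesRegularity-27585 --as helper`; route-independent imports).

The algebraic tool named «WHAT IS MISSING» in HOME engine/engine-1/RECORD-OF-CUSTODY-engine1-g73.md §3(a) for the persistence road to the
general two-shell window rungs `CoZonal.TwoShellWindowRigidity l₁ l₂`, written in the W1 cell's currency (`PoloidalLiouville.HorizonTower.Zonal`:
the isotropic chart `chartT p (t) = p(1 − t², i(1 + t²), 2t)`, which kills exactly the multiples of `ρ = |x|²` and is injective on solid
harmonics, `Zonal.eq_zero_of_chartT_map_eq_zero`).  For a NONZERO REAL solid harmonic `P` (homogeneous, `lapP P = 0`) of degree `l ≥ 1`: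

* (T1) `chartT(P) ≠ 0`, hence `chartT(P)² ≠ 0` — `|x|² ∤ P²` (`chartT_map_ne_zero`, `chartT_map_sq_ne_zero`);
* ★ (T2) `chartT(∇P·∇P) ≠ 0` — `|x|² ∤ |∇P|²`, i.e. the degree-`(2l−2)` spherical-harmonic component of `|∇Y|²` never vanishes
  (`chartT_map_dotP_ne_zero`).  PROOF.  Along the chart `ε(t)` the frame `ε, ε′, μ = ½(1,−i,0)` has Gram matrix `ε·ε = ε·ε′ = μ·μ = μ·ε′ = 0`,
  `μ·ε = 1`, `ε′·ε′ = 4`, so `4 v·v = (v·ε′)² + 8(v·μ)(v·ε)` (`frame_sq_identity`); with `v = ∇P(ε)`, the chain rule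
  (`Zonal.derivative_chartT`), Euler (`Zonal.chartT_euler`) and `ΔP = 0` (trace form `frame_trace_identity`) this gives, for `f = chartT P` and
  `g = chartT(∂₀P − i∂₁P)`, `4·chartT(∇P·∇P) = f′² + 4l·f·g` and `f″ = −2(2l−1)·g`, whence the HESSIAN-COVARIANT IDENTITY
  `4(2l−1)·chartT(∇P·∇P) = (2l−1)f′² − 2l·f·f″` (`chartT_dotP_eq`).  If the left side vanished, `2l·f·f″ = (2l−1)·f′·f′` is a weighted
  Wronskian law, so `f = γ·(t − t₀)^{2l}` or `f = γ` (W1 `wronskian_pow_pow_eq_zero`, `exists_C_mul_of_wronskian_eq_zero`,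
  `exists_monic_eq_C_mul_pow_of_coprime`); both are the charts of `γ·⟪a,x⟫^l` for an explicit ISOTROPIC `a ∈ ℂ³` (`a·a = 0`, so `⟪a,x⟫^l` is
  harmonic), hence `P_ℂ = γ⟪a,x⟫^l` by injectivity of the chart; conjugating (`Zonal.map_conj_map_ofReal`) and evaluating at `ā` gives
  `γ·‖a‖^{2l} = γ̄·(ā·ā)^l = 0`, so `P = 0`.  (Classically: the Hessian covariant of a binary form vanishes iff the form is a perfect power,
  and a real harmonic is never `⟪a,x⟫^l` with `a ≠ 0` isotropic.)

HONEST LABEL: polynomial algebra about solid harmonics (support of a rung line); nothing here bears on `UnthreadedRigidity` (27585), the door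
Target, W2 or Navier–Stokes regularity; no summit statement is proved.  MODEL/rung work; 0 kit.  [folklore]
-/

noncomputable section

-- the summit and its single sub-problem share the name (CONVENTIONS §1), as in every Theorems file
set_option linter.dupNamespace false

namespace Summit.NavierStokesRegularity.NavierStokesRegularity.Theorems.UnthreadedRigidity.MixedPair

open MvPolynomial Complex
open scoped Polynomial ComplexConjugate
open Summit.NavierStokesRegularity.NavierStokesRegularity.Theorems.PoloidalLiouville.HorizonTower.Zonal

/-! ## §1 The frame along the chart: two identities in `ℂ[t]` -/

/-- `i·i = −1` in `ℂ[t]`. -/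
theorem C_I_mul_C_I : Polynomial.C I * Polynomial.C I = (-1 : ℂ[X]) := by
  rw [← Polynomial.C_mul, I_mul_I, Polynomial.C_neg, Polynomial.C_1]

/-- THE FRAME IDENTITY along the chart: `4 v·v = (v·ε′)² + 4 (v₀ − i v₁)(v·ε)` for every `v ∈ ℂ[t]³` (`ε = chartT x`, `ε′ = dε/dt`;
`v₀ − i v₁ = 2 v·μ` with `μ = ½(1,−i,0)`, and `{ε, ε′, μ}` has Gram matrix `μ·ε = 1`, `ε′·ε′ = 4`, all other products `0`). [folklore] -/
theorem frame_sq_identity (v : Fin 3 → ℂ[X]) :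
    4 * (v 0 * v 0 + v 1 * v 1 + v 2 * v 2) =
      (v 0 * Polynomial.derivative (chartT (X 0 : MvPolynomial (Fin 3) ℂ))
          + v 1 * Polynomial.derivative (chartT (X 1 : MvPolynomial (Fin 3) ℂ))
          + v 2 * Polynomial.derivative (chartT (X 2 : MvPolynomial (Fin 3) ℂ))) ^ 2
        + 4 * (v 0 - Polynomial.C I * v 1)
            * (v 0 * chartT (X 0 : MvPolynomial (Fin 3) ℂ) + v 1 * chartT (X 1 : MvPolynomial (Fin 3) ℂ)
                + v 2 * chartT (X 2 : MvPolynomial (Fin 3) ℂ)) := by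
  rw [derivative_chartT_X_zero, derivative_chartT_X_one, derivative_chartT_X_two, chartT_X_zero, chartT_X_one, chartT_X_two]
  linear_combination (4 * v 1 * v 1) * C_I_mul_C_I

/-- THE TRACE FORM of the frame identity: `4 tr M = Σⱼₖ Mⱼₖ ε′ⱼ ε′ₖ + 4 Σₖ (M₀ₖ − i M₁ₖ) εₖ` for a SYMMETRIC `M ∈ ℂ[t]^{3×3}` (written out
with the six independent entries). [folklore] -/
theorem frame_trace_identity (M : Fin 3 → Fin 3 → ℂ[X]) (hM : ∀ j k, M j k = M k j) :
    4 * (M 0 0 + M 1 1 + M 2 2) =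
      (M 0 0 * Polynomial.derivative (chartT (X 0 : MvPolynomial (Fin 3) ℂ)) * Polynomial.derivative (chartT (X 0 : MvPolynomial (Fin 3) ℂ))
        + M 1 1 * Polynomial.derivative (chartT (X 1 : MvPolynomial (Fin 3) ℂ)) * Polynomial.derivative (chartT (X 1 : MvPolynomial (Fin 3) ℂ))
        + M 2 2 * Polynomial.derivative (chartT (X 2 : MvPolynomial (Fin 3) ℂ)) * Polynomial.derivative (chartT (X 2 : MvPolynomial (Fin 3) ℂ))
        + 2 * M 0 1 * Polynomial.derivative (chartT (X 0 : MvPolynomial (Fin 3) ℂ)) * Polynomial.derivative (chartT (X 1 : MvPolynomial (Fin 3) ℂ))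
        + 2 * M 0 2 * Polynomial.derivative (chartT (X 0 : MvPolynomial (Fin 3) ℂ)) * Polynomial.derivative (chartT (X 2 : MvPolynomial (Fin 3) ℂ))
        + 2 * M 1 2 * Polynomial.derivative (chartT (X 1 : MvPolynomial (Fin 3) ℂ)) * Polynomial.derivative (chartT (X 2 : MvPolynomial (Fin 3) ℂ)))
      + 4 * ((M 0 0 - Polynomial.C I * M 0 1) * chartT (X 0 : MvPolynomial (Fin 3) ℂ)
          + (M 0 1 - Polynomial.C I * M 1 1) * chartT (X 1 : MvPolynomial (Fin 3) ℂ)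
          + (M 0 2 - Polynomial.C I * M 1 2) * chartT (X 2 : MvPolynomial (Fin 3) ℂ)) := by
  have _ := hM
  rw [derivative_chartT_X_zero, derivative_chartT_X_one, derivative_chartT_X_two, chartT_X_zero, chartT_X_one, chartT_X_two]
  linear_combination (4 * M 1 1) * C_I_mul_C_I

/-! ## §2 The Hessian-covariant identity `4(2l−1)·chartT(∇P·∇P) = (2l−1)f′² − 2l·f·f″` -/

section Hessian

variable {P : MvPolynomial (Fin 3) ℂ} {m : ℕ}

/-- second `t`-derivatives of the chart components: `ε″ = (−2, 2i, 0)`. -/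
theorem derivative_derivative_chartT_X :
    Polynomial.derivative (Polynomial.derivative (chartT (X 0 : MvPolynomial (Fin 3) ℂ))) = -2 ∧
    Polynomial.derivative (Polynomial.derivative (chartT (X 1 : MvPolynomial (Fin 3) ℂ))) = Polynomial.C I * 2 ∧
    Polynomial.derivative (Polynomial.derivative (chartT (X 2 : MvPolynomial (Fin 3) ℂ))) = 0 := by
  refine ⟨?_, ?_, by rw [derivative_chartT_X_two]; simp⟩
  · rw [derivative_chartT_X_zero, Polynomial.derivative_neg, Polynomial.derivative_mul]; simp
  · rw [derivative_chartT_X_one, Polynomial.derivative_mul, Polynomial.derivative_C, zero_mul, zero_add, Polynomial.derivative_mul]; simp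

/-- the chain rule on the chart, three components written out. -/
theorem derivative_chartT_three (Q : MvPolynomial (Fin 3) ℂ) :
    Polynomial.derivative (chartT Q) =
      chartT (pderiv 0 Q) * Polynomial.derivative (chartT (X 0 : MvPolynomial (Fin 3) ℂ))
        + chartT (pderiv 1 Q) * Polynomial.derivative (chartT (X 1 : MvPolynomial (Fin 3) ℂ))
        + chartT (pderiv 2 Q) * Polynomial.derivative (chartT (X 2 : MvPolynomial (Fin 3) ℂ)) := by
  rw [derivative_chartT, Fin.sum_univ_three]

/-- Euler's identity on the chart, three components written out. -/
theorem chartT_euler_three {Q : MvPolynomial (Fin 3) ℂ} {n : ℕ} (hQ : Q.IsHomogeneous n) :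
    chartT (pderiv 0 Q) * chartT (X 0 : MvPolynomial (Fin 3) ℂ) + chartT (pderiv 1 Q) * chartT (X 1 : MvPolynomial (Fin 3) ℂ)
        + chartT (pderiv 2 Q) * chartT (X 2 : MvPolynomial (Fin 3) ℂ) = (n : ℂ[X]) * chartT Q := by
  rw [← chartT_euler hQ, Fin.sum_univ_three]

/-- ★ THE HESSIAN-COVARIANT IDENTITY: for a complex solid harmonic `P` of degree `m + 1` with chart `f = chartT P`,
`4(2m+1)·chartT(∇P·∇P) = (2m+1)·f′·f′ − (2m+2)·f·f″`. [folklore] -/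
theorem chartT_dotP_eq (hP : P.IsHomogeneous (m + 1)) (hlap : lapP P = 0) :
    4 * ((2 * m + 1 : ℕ) : ℂ[X]) * chartT (dotP P P) =
      ((2 * m + 1 : ℕ) : ℂ[X]) * Polynomial.derivative (chartT P) * Polynomial.derivative (chartT P)
        - ((2 * m + 2 : ℕ) : ℂ[X]) * chartT P * Polynomial.derivative (Polynomial.derivative (chartT P)) := by
  -- names: first derivatives `D j`, Hessian `H j k`, frame `e, e'`
  set f : ℂ[X] := chartT P with hf
  set D0 : ℂ[X] := chartT (pderiv 0 P) with hD0
  set D1 : ℂ[X] := chartT (pderiv 1 P) with hD1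
  set D2 : ℂ[X] := chartT (pderiv 2 P) with hD2
  set e0 : ℂ[X] := chartT (X 0 : MvPolynomial (Fin 3) ℂ) with he0
  set e1 : ℂ[X] := chartT (X 1 : MvPolynomial (Fin 3) ℂ) with he1
  set e2 : ℂ[X] := chartT (X 2 : MvPolynomial (Fin 3) ℂ) with he2
  set d0 : ℂ[X] := Polynomial.derivative (chartT (X 0 : MvPolynomial (Fin 3) ℂ)) with hd0
  set d1 : ℂ[X] := Polynomial.derivative (chartT (X 1 : MvPolynomial (Fin 3) ℂ)) with hd1
  set d2 : ℂ[X] := Polynomial.derivative (chartT (X 2 : MvPolynomial (Fin 3) ℂ)) with hd2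
  set H : Fin 3 → Fin 3 → ℂ[X] := fun j k => chartT (pderiv j (pderiv k P)) with hH
  have hsymm : ∀ j k, H j k = H k j := fun j k => by simp only [hH, pderiv_pderiv_comm j k P]
  -- chain rule for `f` and for the `D j`
  have hf' : Polynomial.derivative f = D0 * d0 + D1 * d1 + D2 * d2 := derivative_chartT_three P
  have hD0' : Polynomial.derivative D0 = H 0 0 * d0 + H 1 0 * d1 + H 2 0 * d2 := derivative_chartT_three (pderiv 0 P)
  have hD1' : Polynomial.derivative D1 = H 0 1 * d0 + H 1 1 * d1 + H 2 1 * d2 := derivative_chartT_three (pderiv 1 P)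
  have hD2' : Polynomial.derivative D2 = H 0 2 * d0 + H 1 2 * d1 + H 2 2 * d2 := derivative_chartT_three (pderiv 2 P)
  -- Euler for `P` and for the `∂ⱼP` (degree `m`), trace `= 0`
  have hEu : D0 * e0 + D1 * e1 + D2 * e2 = ((m + 1 : ℕ) : ℂ[X]) * f := chartT_euler_three hP
  have hEu0 : H 0 0 * e0 + H 1 0 * e1 + H 2 0 * e2 = (m : ℂ[X]) * D0 := by
    have h := chartT_euler_three (hP.pderiv (i := 0)); rwa [Nat.add_sub_cancel] at h
  have hEu1 : H 0 1 * e0 + H 1 1 * e1 + H 2 1 * e2 = (m : ℂ[X]) * D1 := by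
    have h := chartT_euler_three (hP.pderiv (i := 1)); rwa [Nat.add_sub_cancel] at h
  have htr : H 0 0 + H 1 1 + H 2 2 = 0 := by
    have h := congrArg chartT hlap
    rwa [lapP, chartT_add, chartT_add, chartT_zero] at h
  -- second derivatives of the frame
  obtain ⟨hdd0, hdd1, hdd2⟩ := derivative_derivative_chartT_X
  -- `f″ = −2(2m+1) g`, `g = D0 − i D1`
  have htrace := frame_trace_identity H hsymm
  rw [htr, mul_zero] at htrace
  have hf'' : Polynomial.derivative (Polynomial.derivative f) = -(2 * ((2 * m + 1 : ℕ) : ℂ[X])) * (D0 - Polynomial.C I * D1) := by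
    rw [hf', Polynomial.derivative_add, Polynomial.derivative_add, Polynomial.derivative_mul, Polynomial.derivative_mul,
      Polynomial.derivative_mul, hD0', hD1', hD2', hdd0, hdd1, hdd2]
    rw [hsymm 1 0, hsymm 2 0, hsymm 2 1] at *
    push_cast
    linear_combination (-1 : ℂ[X]) * htrace + (-4 : ℂ[X]) * hEu0 + (4 * Polynomial.C I) * hEu1
  -- `4 chartT(∇P·∇P) = f′² + 4(m+1) f g`
  have hframe := frame_sq_identity ![D0, D1, D2]
  simp only [Matrix.cons_val_zero, Matrix.cons_val_one, Matrix.cons_val] at hframe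
  have hdot : chartT (dotP P P) = D0 * D0 + D1 * D1 + D2 * D2 := by
    simp only [dotP, chartT_add, chartT_mul, hD0, hD1, hD2]
  rw [hdot, hf'', hf]
  rw [hf] at hf' hEu
  rw [hf']
  push_cast at hEu ⊢
  linear_combination ((2 * (m : ℂ[X]) + 1)) * hframe + (4 * (D0 - Polynomial.C I * D1) * (2 * (m : ℂ[X]) + 1)) * hEu

end Hessian

/-! ## §3 Isotropic linear forms and the vanishing Hessian covariant -/

section Power

/-- `∂ⱼ⟪a,x⟫ = aⱼ` (the linear form written out as `a₀x₀ + a₁x₁ + a₂x₂`). -/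
theorem pderiv_lin (a : Fin 3 → ℂ) (j : Fin 3) :
    pderiv j (C (a 0) * X 0 + C (a 1) * X 1 + C (a 2) * X 2 : MvPolynomial (Fin 3) ℂ) = C (a j) := by
  fin_cases j <;>
    simp [pderiv_X_of_ne (show (1 : Fin 3) ≠ 0 by decide), pderiv_X_of_ne (show (2 : Fin 3) ≠ 0 by decide),
      pderiv_X_of_ne (show (0 : Fin 3) ≠ 1 by decide), pderiv_X_of_ne (show (2 : Fin 3) ≠ 1 by decide),
      pderiv_X_of_ne (show (0 : Fin 3) ≠ 2 by decide), pderiv_X_of_ne (show (1 : Fin 3) ≠ 2 by decide)]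

/-- `∇⟪a,x⟫·∇⟪a,x⟫ = a·a`. -/
theorem dotP_lin_lin (a : Fin 3 → ℂ) :
    dotP (C (a 0) * X 0 + C (a 1) * X 1 + C (a 2) * X 2 : MvPolynomial (Fin 3) ℂ) (C (a 0) * X 0 + C (a 1) * X 1 + C (a 2) * X 2)
      = C (a 0 ^ 2 + a 1 ^ 2 + a 2 ^ 2) := by
  simp only [dotP, pderiv_lin]
  simp only [map_add, sq, map_mul]

/-- `Δ⟪a,x⟫ = 0`. -/
theorem lapP_lin (a : Fin 3 → ℂ) : lapP (C (a 0) * X 0 + C (a 1) * X 1 + C (a 2) * X 2 : MvPolynomial (Fin 3) ℂ) = 0 := by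
  simp only [lapP, pderiv_lin, pderiv_C, add_zero]

/-- POWERS OF AN ISOTROPIC LINEAR FORM ARE HARMONIC: `a·a = 0 ⇒ Δ(⟪a,x⟫ⁿ) = 0` (with `∇⟪a,x⟫·∇(⟪a,x⟫ⁿ) = 0` carried along the
induction). [folklore] -/
theorem lapP_lin_pow_of_isotropic {a : Fin 3 → ℂ} (ha : a 0 ^ 2 + a 1 ^ 2 + a 2 ^ 2 = 0) (n : ℕ) :
    lapP ((C (a 0) * X 0 + C (a 1) * X 1 + C (a 2) * X 2 : MvPolynomial (Fin 3) ℂ) ^ n) = 0 ∧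
      dotP (C (a 0) * X 0 + C (a 1) * X 1 + C (a 2) * X 2 : MvPolynomial (Fin 3) ℂ)
        ((C (a 0) * X 0 + C (a 1) * X 1 + C (a 2) * X 2) ^ n) = 0 := by
  set L : MvPolynomial (Fin 3) ℂ := C (a 0) * X 0 + C (a 1) * X 1 + C (a 2) * X 2 with hL
  have hLL : dotP L L = 0 := by rw [hL, dotP_lin_lin, ha, C_0]
  have hL0 : lapP L = 0 := lapP_lin a
  induction n with
  | zero => exact ⟨by simp [lapP], by simp [dotP]⟩
  | succ n ih =>
    obtain ⟨h1, h2⟩ := ih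
    refine ⟨?_, ?_⟩
    · rw [pow_succ, lapP_mul, hL0, h1, dotP_comm, h2]; ring
    · rw [pow_succ, dotP_comm, dotP_mul_left, hLL, dotP_comm, h2]; ring

/-- a linear form is homogeneous of degree one (the W1 lemma, re-exported in the shape used below). -/
theorem isHomogeneous_lin_pow (a : Fin 3 → ℂ) (n : ℕ) :
    ((C (a 0) * X 0 + C (a 1) * X 1 + C (a 2) * X 2 : MvPolynomial (Fin 3) ℂ) ^ n).IsHomogeneous n := by
  have h := (isHomogeneous_lin a).pow n
  rwa [one_mul] at h

/-- THE ISOTROPIC VECTOR WITH CHART `(t − t₀)²`: `a(t₀) = ((t₀² − 1)/2, −i(t₀² + 1)/2, −t₀)` has `a·a = 0` and `chartT ⟪a,x⟫ = (t − t₀)²`. -/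
theorem chartT_lin_root (t₀ : ℂ) :
    (((t₀ ^ 2 - 1) / 2) ^ 2 + (-I * (t₀ ^ 2 + 1) / 2) ^ 2 + (-t₀) ^ 2 = 0) ∧
    chartT (C ((t₀ ^ 2 - 1) / 2) * X 0 + C (-I * (t₀ ^ 2 + 1) / 2) * X 1 + C (-t₀) * X 2 : MvPolynomial (Fin 3) ℂ)
      = (Polynomial.X - Polynomial.C t₀) ^ 2 := by
  refine ⟨?_, ?_⟩
  · have hI : I * I = -1 := I_mul_I
    linear_combination ((t₀ ^ 2 + 1) ^ 2 / 4) * hI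
  · have h := chartT_lin ![(t₀ ^ 2 - 1) / 2, -I * (t₀ ^ 2 + 1) / 2, -t₀]
    simp only [Matrix.cons_val_zero, Matrix.cons_val_one, Matrix.cons_val] at h
    rw [h]
    have e0 : (t₀ ^ 2 - 1) / 2 + I * (-I * (t₀ ^ 2 + 1) / 2) = t₀ ^ 2 := by
      have hI : I * I = -1 := I_mul_I
      linear_combination (-(t₀ ^ 2 + 1) / 2) * hI
    have e2 : I * (-I * (t₀ ^ 2 + 1) / 2) - (t₀ ^ 2 - 1) / 2 = 1 := by
      have hI : I * I = -1 := I_mul_I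
      linear_combination (-(t₀ ^ 2 + 1) / 2) * hI
    rw [e0, e2]
    simp only [Polynomial.C_1, one_mul, Polynomial.C_mul, Polynomial.C_neg, Polynomial.C_pow, Polynomial.C_ofNat]
    ring

/-- THE ISOTROPIC VECTOR WITH CHART `1`: `μ = (½, −i/2, 0)` has `μ·μ = 0` and `chartT ⟪μ,x⟫ = 1`. -/
theorem chartT_lin_mu :
    (((1 : ℂ) / 2) ^ 2 + (-I / 2) ^ 2 + (0 : ℂ) ^ 2 = 0) ∧
    chartT (C ((1 : ℂ) / 2) * X 0 + C (-I / 2) * X 1 + C (0 : ℂ) * X 2 : MvPolynomial (Fin 3) ℂ) = 1 := by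
  refine ⟨?_, ?_⟩
  · have hI : I * I = -1 := I_mul_I
    linear_combination (1 / 4 : ℂ) * hI
  · have h := chartT_lin ![(1 : ℂ) / 2, -I / 2, 0]
    simp only [Matrix.cons_val_zero, Matrix.cons_val_one, Matrix.cons_val] at h
    rw [h]
    have e0 : (1 : ℂ) / 2 + I * (-I / 2) = 1 := by
      have hI : I * I = -1 := I_mul_I
      linear_combination (-1 / 2 : ℂ) * hI
    have e2 : I * (-I / 2) - (1 : ℂ) / 2 = 0 := by
      have hI : I * I = -1 := I_mul_I
      linear_combination (-1 / 2 : ℂ) * hI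
    rw [e0, e2]
    simp

variable {P : MvPolynomial (Fin 3) ℂ} {m : ℕ}

/-- THE CHART OF A SOLID HARMONIC WITH `chartT(∇P·∇P) = 0` IS A PERFECT `(2m+2)`-TH POWER: `chartT P = γ·(t − t₀)^{2m+2}` or `chartT P = γ`
(the weighted Wronskian law `(2m+2) f f″ = (2m+1) f′ f′` and the W1 root arithmetic). [folklore] -/
theorem chartT_eq_pow_of_chartT_dotP_eq_zero (hP : P.IsHomogeneous (m + 1)) (hlap : lapP P = 0) (h0 : chartT (dotP P P) = 0) :
    ∃ γ : ℂ, (∃ t₀ : ℂ, chartT P = Polynomial.C γ * (Polynomial.X - Polynomial.C t₀) ^ (2 * m + 2)) ∨ chartT P = Polynomial.C γ := by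
  set f : ℂ[X] := chartT P with hf
  have hode : ((2 * m + 2 : ℕ) : ℂ[X]) * f * Polynomial.derivative (Polynomial.derivative f) =
      ((2 * m + 1 : ℕ) : ℂ[X]) * Polynomial.derivative f * Polynomial.derivative f := by
    have h := chartT_dotP_eq hP hlap
    rw [h0, mul_zero] at h
    linear_combination h
  by_cases hf1 : Polynomial.derivative f = 0
  · -- constant chart
    refine ⟨f.coeff 0, Or.inr ?_⟩
    exact Polynomial.eq_C_of_derivative_eq_zero hf1
  · have hf0 : f ≠ 0 := fun h => hf1 (by rw [h, Polynomial.derivative_zero])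
    -- the Wronskian of `f^{2m+1}` and `(f′)^{2m+2}` vanishes
    have hW : Polynomial.wronskian (f ^ (2 * m + 1)) (Polynomial.derivative f ^ (2 * m + 2)) = 0 :=
      wronskian_pow_pow_eq_zero (by omega) (by omega) hode
    obtain ⟨c, hc⟩ := exists_C_mul_of_wronskian_eq_zero (pow_ne_zero _ hf1) hW
    have hc0 : c ≠ 0 := by
      rintro rfl
      rw [Polynomial.C_0, zero_mul] at hc
      exact hf0 (pow_eq_zero_iff (by omega : 2 * m + 1 ≠ 0) |>.mp hc)
    have hc' : Polynomial.derivative f ^ (2 * m + 2) = Polynomial.C c⁻¹ * f ^ (2 * m + 1) := by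
      rw [hc, ← mul_assoc, ← Polynomial.C_mul, inv_mul_cancel₀ hc0, Polynomial.C_1, one_mul]
    have hcop : (2 * m + 2).Coprime (2 * m + 1) := by
      rw [show 2 * m + 2 = 1 + (2 * m + 1) by ring, Nat.coprime_add_self_left]
      exact Nat.coprime_one_left _
    obtain ⟨q, hqm, hfq, hdeg⟩ := exists_monic_eq_C_mul_pow_of_coprime hcop (by omega) hf1 hc'
    have hdf : f.natDegree ≤ 2 * (m + 1) := natDegree_chartT_le hP
    have hq1 : q.natDegree = 1 := by
      have hle : q.natDegree ≤ 1 := by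
        have key : (2 * m + 2) * q.natDegree ≤ (2 * m + 2) * 1 := by rw [mul_one, hdeg]; omega
        exact Nat.le_of_mul_le_mul_left key (by omega)
      rcases Nat.lt_or_ge q.natDegree 1 with h | h
      · exfalso
        have hq0 : q = 1 := (Polynomial.Monic.natDegree_eq_zero hqm).mp (by omega)
        rw [hq0, one_pow, mul_one] at hfq
        apply hf1
        rw [hfq, Polynomial.derivative_C]
      · omega
    refine ⟨f.leadingCoeff, Or.inl ⟨-q.coeff 0, ?_⟩⟩
    rw [Polynomial.C_neg, sub_neg_eq_add, ← Polynomial.Monic.eq_X_add_C hqm hq1]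
    exact hfq

/-- ★ A SOLID HARMONIC WITH `chartT(∇P·∇P) = 0` IS `γ·⟪a,x⟫^{m+1}` WITH `a` ISOTROPIC (injectivity of the chart on harmonics,
`Zonal.eq_zero_of_chartT_eq_zero`). [folklore] -/
theorem exists_lin_pow_of_chartT_dotP_eq_zero (hP : P.IsHomogeneous (m + 1)) (hlap : lapP P = 0) (h0 : chartT (dotP P P) = 0) :
    ∃ (γ : ℂ) (a : Fin 3 → ℂ), a 0 ^ 2 + a 1 ^ 2 + a 2 ^ 2 = 0 ∧
      P = C γ * (C (a 0) * X 0 + C (a 1) * X 1 + C (a 2) * X 2) ^ (m + 1) := by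
  -- an isotropic `a` and `γ` with `chartT (γ ⟪a,x⟫^{m+1}) = chartT P`
  obtain ⟨γ, a, ha, hchart⟩ : ∃ (γ : ℂ) (a : Fin 3 → ℂ), a 0 ^ 2 + a 1 ^ 2 + a 2 ^ 2 = 0 ∧
      chartT (C γ * (C (a 0) * X 0 + C (a 1) * X 1 + C (a 2) * X 2) ^ (m + 1)) = chartT P := by
    obtain ⟨γ, ⟨t₀, h⟩ | h⟩ := chartT_eq_pow_of_chartT_dotP_eq_zero hP hlap h0
    · obtain ⟨ha, hc⟩ := chartT_lin_root t₀
      refine ⟨γ, ![(t₀ ^ 2 - 1) / 2, -I * (t₀ ^ 2 + 1) / 2, -t₀], ?_, ?_⟩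
      · simpa using ha
      · simp only [Matrix.cons_val_zero, Matrix.cons_val_one, Matrix.cons_val]
        rw [chartT_mul, chartT_C, chartT_pow, hc, h, ← pow_mul, show 2 * (m + 1) = 2 * m + 2 by ring]
    · obtain ⟨ha, hc⟩ := chartT_lin_mu
      refine ⟨γ, ![(1 : ℂ) / 2, -I / 2, 0], ?_, ?_⟩
      · simpa using ha
      · simp only [Matrix.cons_val_zero, Matrix.cons_val_one, Matrix.cons_val]
        rw [chartT_mul, chartT_C, chartT_pow, hc, h, one_pow, mul_one]
  refine ⟨γ, a, ha, ?_⟩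
  set L : MvPolynomial (Fin 3) ℂ := C (a 0) * X 0 + C (a 1) * X 1 + C (a 2) * X 2 with hL
  have hhom : (P - C γ * L ^ (m + 1)).IsHomogeneous (m + 1) := by
    refine hP.sub ?_
    have h := (isHomogeneous_C (Fin 3) γ).mul (isHomogeneous_lin_pow a (m + 1))
    rwa [zero_add] at h
  have hlap' : lapP (P - C γ * L ^ (m + 1)) = 0 := by
    rw [lapP_sub, lapP_C_mul, hlap, (lapP_lin_pow_of_isotropic ha (m + 1)).1, mul_zero, sub_zero]
  have hzero := eq_zero_of_chartT_eq_zero hhom hlap' (by rw [chartT_sub, hchart, sub_self])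
  exact (sub_eq_zero.mp hzero)

end Power

/-! ## §4 Reality, and the two top-component lemmas -/

/-- REALITY: a REAL polynomial which over `ℂ` is `γ·⟪a,x⟫^{n+1}` with `a` ISOTROPIC is zero (conjugate with
`Zonal.map_conj_map_ofReal` and evaluate at `ā`: `γ‖a‖^{2(n+1)} = γ̄ (ā·ā)^{n+1} = 0`). [folklore] -/
theorem eq_zero_of_map_eq_C_mul_lin_pow {P : MvPolynomial (Fin 3) ℝ} {γ : ℂ} {a : Fin 3 → ℂ} {n : ℕ}
    (ha : a 0 ^ 2 + a 1 ^ 2 + a 2 ^ 2 = 0)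
    (h : map (algebraMap ℝ ℂ) P = C γ * (C (a 0) * X 0 + C (a 1) * X 1 + C (a 2) * X 2) ^ (n + 1)) : P = 0 := by
  set σ := starRingEnd ℂ with hσ
  -- conjugate the identity
  have hconj : C γ * (C (a 0) * X 0 + C (a 1) * X 1 + C (a 2) * X 2 : MvPolynomial (Fin 3) ℂ) ^ (n + 1)
      = C (σ γ) * (C (σ (a 0)) * X 0 + C (σ (a 1)) * X 1 + C (σ (a 2)) * X 2) ^ (n + 1) := by
    have h1 := congrArg (map σ) h
    rw [map_conj_map_ofReal, h] at h1
    rw [h1]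
    simp only [map_mul, map_C, map_pow, map_add, map_X]
  -- evaluate at `ā`
  have hev := congrArg (eval fun j => σ (a j)) hconj
  simp only [eval_mul, eval_C, eval_pow, eval_add, eval_X] at hev
  have hiso : σ (a 0) * σ (a 0) + σ (a 1) * σ (a 1) + σ (a 2) * σ (a 2) = 0 := by
    have := congrArg σ ha
    simpa [sq, map_add, map_mul] using this
  have hnorm : a 0 * σ (a 0) + a 1 * σ (a 1) + a 2 * σ (a 2) = ((normSq (a 0) + normSq (a 1) + normSq (a 2) : ℝ) : ℂ) := by
    rw [hσ, mul_conj, mul_conj, mul_conj]; push_cast; ring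
  rw [hiso, zero_pow (Nat.succ_ne_zero n), mul_zero, hnorm] at hev
  have hinj := map_injective (σ := Fin 3) (algebraMap ℝ ℂ) (RCLike.ofReal_injective (K := ℂ))
  have hmap0 : map (algebraMap ℝ ℂ) P = 0 := by
    rcases mul_eq_zero.mp hev with hγ | hN
    · rw [h, hγ, C_0, zero_mul]
    · have hN' : normSq (a 0) + normSq (a 1) + normSq (a 2) = 0 := by
        have := (pow_eq_zero_iff (Nat.succ_ne_zero n)).mp hN
        exact_mod_cast this
      have h0 : normSq (a 0) = 0 := by linarith [normSq_nonneg (a 0), normSq_nonneg (a 1), normSq_nonneg (a 2)]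
      have h1 : normSq (a 1) = 0 := by linarith [normSq_nonneg (a 0), normSq_nonneg (a 1), normSq_nonneg (a 2)]
      have h2 : normSq (a 2) = 0 := by linarith [normSq_nonneg (a 0), normSq_nonneg (a 1), normSq_nonneg (a 2)]
      rw [normSq_eq_zero] at h0 h1 h2
      rw [h, h0, h1, h2, C_0, zero_mul, zero_mul, zero_mul, zero_add, zero_add, zero_pow (Nat.succ_ne_zero n), mul_zero]
  exact hinj (by rw [hmap0, map_zero])

/-- (T1) THE CHART OF A NONZERO REAL SOLID HARMONIC IS NONZERO (W1's `Zonal.eq_zero_of_chartT_map_eq_zero`, contraposed). [folklore] -/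
theorem chartT_map_ne_zero {P : MvPolynomial (Fin 3) ℝ} {n : ℕ} (hP : P.IsHomogeneous n) (hlap : lapP P = 0) (h0 : P ≠ 0) :
    chartT (map (algebraMap ℝ ℂ) P) ≠ 0 := fun h => h0 (eq_zero_of_chartT_map_eq_zero hP hlap h)

/-- (T1) `chartT(P²) ≠ 0` — `|x|² ∤ P²`: the degree-`2n` spherical-harmonic component of `Y²` is nonzero. [folklore] -/
theorem chartT_map_sq_ne_zero {P : MvPolynomial (Fin 3) ℝ} {n : ℕ} (hP : P.IsHomogeneous n) (hlap : lapP P = 0) (h0 : P ≠ 0) :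
    chartT (map (algebraMap ℝ ℂ) (P * P)) ≠ 0 := by
  rw [map_mul, chartT_mul]
  exact mul_ne_zero (chartT_map_ne_zero hP hlap h0) (chartT_map_ne_zero hP hlap h0)

/-- ★ (T2) `chartT(∇P·∇P) ≠ 0` FOR A NONZERO REAL SOLID HARMONIC OF DEGREE `m + 1` — `|x|² ∤ |∇P|²`: the degree-`2m` spherical-harmonic
component of `|∇Y|²` is nonzero (module docstring). [folklore] -/
theorem chartT_map_dotP_ne_zero {P : MvPolynomial (Fin 3) ℝ} {m : ℕ} (hP : P.IsHomogeneous (m + 1)) (hlap : lapP P = 0) (h0 : P ≠ 0) :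
    chartT (map (algebraMap ℝ ℂ) (dotP P P)) ≠ 0 := by
  intro h
  have hPc : (map (algebraMap ℝ ℂ) P).IsHomogeneous (m + 1) := hP.map _
  have hlapc : lapP (map (algebraMap ℝ ℂ) P) = 0 := by rw [← map_lapP, hlap, map_zero]
  rw [map_dotP] at h
  obtain ⟨γ, a, ha, hPa⟩ := exists_lin_pow_of_chartT_dotP_eq_zero hPc hlapc h
  exact h0 (eq_zero_of_map_eq_C_mul_lin_pow ha hPa)

/-- ★ (T2), degree stated as `1 ≤ l`. [folklore] -/
theorem chartT_map_dotP_ne_zero' {P : MvPolynomial (Fin 3) ℝ} {l : ℕ} (hl : 1 ≤ l) (hP : P.IsHomogeneous l) (hlap : lapP P = 0)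
    (h0 : P ≠ 0) : chartT (map (algebraMap ℝ ℂ) (dotP P P)) ≠ 0 := by
  obtain ⟨m, rfl⟩ := Nat.exists_eq_add_of_le' hl
  exact chartT_map_dotP_ne_zero hP hlap h0

end Summit.NavierStokesRegularity.NavierStokesRegularity.Theorems.UnthreadedRigidity.MixedPair

end
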